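import Summits.HodgeConjecture.HodgeConjecture.Theorems.H413E2SWHermFormAnisotropic
import Literature.NumberTheory.Weil1965.ThetaIntegralOrbitFunctionalSupport
import Literature.NumberTheory.Automorphic.QuadraticLocalBaseChange
import Mathlib.LinearAlgebra.Matrix.NonsingularInverse
import HarnessLib

/-!
# Crux `H413`, E-2 Siegel–Weil child line — ANISOTROPY OF THE HERMITIAN NORM ON RATIONAL POINTS:
# `hNorm (ratPt ξ) = 0 ↔ ξ = 0` (Weil's rank-0 term: `U(0)_F = ∅`, so `μ̂_0 = 0` in (Θ-DEC))

Cell hodgecm-mathlib (D-0151), FLOOR 0, crux item H413 = stmt-HodgeConjecture-24833, programme P4, engine E-2, the I-CLOSE assembly of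
`Cruxes/H413/Lines/F0_E2SiegelWeilWeilRange.lean` (sheet `SW2-ICLOSE-ASSEMBLY.v0` §1 (Θ-DEC); F0P4-plan (g4) row 2026-08-31T03:11:49Z (1),
division with B-p10 (g16) 03:17:53Z: FILE 2e ★ `Weil1965/ThetaIntegralOrbitFunctionalSupport` exposes the RATIONAL VALUE of `hNorm` on
rational points — `hNorm_ratPt_eq_algebraMap`, `toHermVec_ratPt_apply` — and this file reads the anisotropy off it).  Namespace
`Summit.HodgeConjecture.HodgeConjecture.Cruxes.H413.E2SWHNormAnisotropic`.  Helper file (`--supports stmt-HodgeConjecture-24833 --as helper`);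
THEOREMS ONLY (no `def`, no instance, no notation, no `sorry`, no named fact); imports ★ (G) `Theorems/H413E2SWHermFormAnisotropic`, ★ FILE 2e,
★ `Automorphic/QuadraticLocalBaseChange`, Mathlib (no `Cruxes/…/Lines`, nothing on the R2 reverse cone).  Author A-p18 (g17).

THE ARGUMENT.  For `ξ ∈ F^{n+n}`, FILE 2e gives `hNorm (ratPt ξ) = re Ψ_𝔸 (h(z_ξ, z_ξ) ⊗ 1)` with the rational vector
`z_ξ i = ξ|₁(e i) + (𝕋_F⁻¹ ξ|₂)(e i)·δ ∈ E^{N×1}` and `h` the pairing of `J_V ⊗ₖ J_W` for `c` (`J_V = T_V ⊗ 1`, `J_W = T_W ⊗ 1`, `T_V`, `T_W`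
symmetric `F`-matrices).  §1 (rational bookkeeping in the `(F, E, c, δ)` currency): `{1, δ}` is `F`-free (`algebraMap_add_algebraMap_mul_delta_eq_zero`);
the fixed field of `c` is `F` (`exists_eq_algebraMap_of_algEquiv_apply_eq`, over ★ `exists_eq_add_mul_of_isQuadraticExtension`); `J_V ⊗ₖ J_W` is
`c`-hermitian (`kronecker_map_isHermitian`), so `h(z,z)` is `c`-fixed (`apply_hermForm_self_eq`) hence `= t ⊗ 1`, `t ∈ F`
(`exists_hermForm_self_eq_algebraMap`); and `z_ξ = 0 ⇒ ξ = 0` (`eq_zero_of_ratCoords_eq_zero`, ★ `UnitaryDualPair.isUnit_det_gram`).  §2: with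
`hNorm_ratPt_eq_algebraMap` (FILE 2e) `hNorm (ratPt ξ) = t`, so `hNorm (ratPt ξ) = 0 ⇒ t = 0` (`F ↪ 𝔸_F`) `⇒ h(z_ξ, z_ξ) = 0 ⇒ z_ξ = 0` by the
anisotropy of `J_V ⊗ₖ J_W` at the definite embedding `τ` (★ (G) `hermForm_kronecker_one_self_eq_zero_imp_of_posDef_map_quadratic`; `J_W` invertible
`1 × 1`, no sign condition) `⇒ ξ = 0`: **`hNorm_ratPt_eq_zero_iff`**.  CM binders exactly as in ★ L1 ED. 3
(`[IsTotallyReal F] [IsTotallyComplex E] (τ : E →+* ℂ) (hτ : ((TV.map (algebraMap F E)).map τ).PosDef)`).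

HC_CM is proved only modulo the 7 printed citations until rung 0 closes; this file is linear algebra over FILE 2e and proves nothing printed.

References: [Weil1965] A. Weil, Acta Math. 113 (1965), n° 52 (rank-0 term of the theta integral), Chap. IV n° 41 (35) p. 59 (`i_X`);
[GelbartRogawski1991] §3.1 p. 454 (rational points of the doubled pair).
-/

set_option autoImplicit false
-- the mandated namespace has the single-problem summit's repeated segment (`HodgeConjecture.HodgeConjecture`)
set_option linter.dupNamespace false

open scoped Matrix Kronecker ComplexOrder
open NumberField
open Literature.NumberTheory.Automorphic Literature.NumberTheory.Automorphic.UnitaryGroup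
open Literature.NumberTheory.Weil1964 Literature.NumberTheory.Weil1965 Literature.NumberTheory.Weil1965.UnitaryDoubling
open Literature.NumberTheory.GelbartRogawski1991 Literature.NumberTheory.GelbartRogawski1991.UnitaryDualPair
open Summit.HodgeConjecture.HodgeConjecture.Cruxes.H413.E2SWHermFormAnisotropic

namespace Summit.HodgeConjecture.HodgeConjecture.Cruxes.H413.E2SWHNormAnisotropic

/-! ## §1 Rational bookkeeping in the `(F, E, c, δ)` currency -/

section Rational

variable {F E : Type} [Field F] [Field E] [Algebra F E] (c : E ≃ₐ[F] E) {δ : E} (hcδ : c δ = -δ) (hδ : δ ≠ 0)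

include hcδ hδ in
/-- **`{1, δ}` is `F`-free**: `a + b δ = 0` with `a, b ∈ F` forces `a = b = 0` (apply `c`: `a − bδ = 0`; characteristic `≠ 2`
is automatic for the cell's number fields, here `CharZero E`). [folklore] -/
theorem algebraMap_add_algebraMap_mul_delta_eq_zero [CharZero E] {a b : F}
    (h : algebraMap F E a + algebraMap F E b * δ = 0) : a = 0 ∧ b = 0 := by
  have hc : algebraMap F E a - algebraMap F E b * δ = 0 := by
    have := congrArg c h
    rwa [map_add, map_mul, AlgEquiv.commutes, AlgEquiv.commutes, hcδ, map_zero, mul_neg, ← sub_eq_add_neg] at this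
  have ha : algebraMap F E a = 0 := by
    have h2 : algebraMap F E a + algebraMap F E a = 0 := by linear_combination h + hc
    exact add_self_eq_zero.1 h2
  have hb : algebraMap F E b * δ = 0 := by rwa [ha, zero_add] at h
  refine ⟨(algebraMap F E).injective (by rw [ha, map_zero]), ?_⟩
  rcases mul_eq_zero.1 hb with hb0 | hδ0
  · exact (algebraMap F E).injective (by rw [hb0, map_zero])
  · exact absurd hδ0 hδ

include hcδ hδ in
/-- **The fixed field of `c` is `F`**: `c x = x ⇒ x = a` for some `a ∈ F` (write `x = a + bδ` ★ `exists_eq_add_mul_of_isQuadraticExtension`;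
`c x = a − bδ`). [folklore] -/
theorem exists_eq_algebraMap_of_algEquiv_apply_eq [NumberField F] [NumberField E] [Algebra.IsQuadraticExtension F E]
    {x : E} (hx : c x = x) : ∃ a : F, x = algebraMap F E a := by
  obtain ⟨a, b, hab⟩ := exists_eq_add_mul_of_isQuadraticExtension E (not_mem_range_algebraMap_of_apply_eq_neg E c hcδ hδ) x
  have hcx : c x = algebraMap F E a - algebraMap F E b * δ := by
    rw [hab, map_add, map_mul, AlgEquiv.commutes, AlgEquiv.commutes, hcδ, mul_neg, ← sub_eq_add_neg]
  have h2 : x = algebraMap F E a - algebraMap F E b * δ := hx.symm.trans hcx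
  have hbb : algebraMap F E (0 : F) + algebraMap F E (b + b) * δ = 0 := by
    rw [map_zero, zero_add, map_add, add_mul]
    linear_combination h2 - hab
  have hb : b = 0 := add_self_eq_zero.1 (algebraMap_add_algebraMap_mul_delta_eq_zero c hcδ hδ hbb).2
  refine ⟨a, ?_⟩
  rw [hab, hb, map_zero, zero_mul, add_zero]

/-- **`h(z, z)` is `σ`-fixed** for an involution `σ` and a `σ`-hermitian Gram matrix `(H.map σ)ᵀ = H` (re-proved here by the
two-line sum swap to keep the imports light; cf. ★ `UnitaryGroup.conj_hermForm`). [folklore] -/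
theorem apply_hermForm_self_eq {S : Type*} [CommRing S] {m : Type*} [Fintype m] (σ : S →+* S) (hσ : ∀ x, σ (σ x) = x)
    (H : Matrix m m S) (hH : (H.map σ)ᵀ = H) (z : m → S) : σ (hermForm σ H z z) = hermForm σ H z z := by
  conv_rhs => rw [← hH]
  simp only [hermForm, dotProduct, Matrix.mulVec, Function.comp_apply, map_sum, map_mul, hσ, Matrix.transpose_apply,
    Matrix.map_apply, Finset.mul_sum]
  rw [Finset.sum_comm]
  exact Finset.sum_congr rfl fun j _ => Finset.sum_congr rfl fun i _ => by ring

/-- **The dual-pair Gram matrix `(T_V ⊗ 1) ⊗ₖ (T_W ⊗ 1)` is `c`-hermitian** when `T_V`, `T_W` are symmetric `F`-matrices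
(`c` fixes `F`). [folklore] -/
theorem kronecker_map_isHermitian {N : ℕ} (TV : Matrix (Fin N) (Fin N) F) (hV : TV.IsSymm) (TW : Matrix (Fin 1) (Fin 1) F)
    (hW : TW.IsSymm) :
    (((TV.map (algebraMap F E)) ⊗ₖ (TW.map (algebraMap F E))).map (c : E →+* E))ᵀ =
      (TV.map (algebraMap F E)) ⊗ₖ (TW.map (algebraMap F E)) := by
  ext ⟨i, a⟩ ⟨j, b⟩
  simp only [Matrix.transpose_apply, Matrix.map_apply, Matrix.kroneckerMap_apply, map_mul, RingHom.coe_coe,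
    AlgEquiv.commutes, hV.apply i j, hW.apply a b]

include hcδ hδ in
/-- **The diagonal value `h(z,z)` of the dual-pair form lies in `F`**. [folklore] -/
theorem exists_hermForm_self_eq_algebraMap [NumberField F] [NumberField E] [Algebra.IsQuadraticExtension F E]
    {N : ℕ} (TV : Matrix (Fin N) (Fin N) F) (hV : TV.IsSymm) (TW : Matrix (Fin 1) (Fin 1) F) (hW : TW.IsSymm)
    (z : Fin N × Fin 1 → E) :
    ∃ t : F, hermForm (c : E →+* E) ((TV.map (algebraMap F E)) ⊗ₖ (TW.map (algebraMap F E))) z z = algebraMap F E t := by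
  refine exists_eq_algebraMap_of_algEquiv_apply_eq c hcδ hδ ?_
  have hσ : ∀ x : E, (c : E →+* E) ((c : E →+* E) x) = x := fun x => by
    have h1 := algEquiv_mul_self_eq_one F (show c ≠ 1 from fun h => by
      rw [h, AlgEquiv.one_apply] at hcδ; exact hδ (add_self_eq_zero.1 (eq_neg_iff_add_eq_zero.1 hcδ)))
    have := congrArg (fun f : E ≃ₐ[F] E => f x) h1
    simpa using this
  exact apply_hermForm_self_eq (c : E →+* E) hσ _ (kronecker_map_isHermitian c TV hV TW hW) z

include c hcδ hδ in
/-- **Reading off `ξ` from the rational hermitian coordinates**: with `z_ξ i = ξ₁(e i) + (gram⁻¹ ξ₂)(e i)·δ` (`ξ₁ = ξ ∘ inl`,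
`ξ₂ = ξ ∘ inr` through `finSumFinEquiv`; FILE 2e's inline rational vector), `z_ξ = 0 ⇒ ξ = 0` — `{1, δ}` is `F`-free and the
Gram matrix is invertible (★ `UnitaryDualPair.isUnit_det_gram`). [folklore] -/
theorem eq_zero_of_ratCoords_eq_zero [CharZero E] [NumberField F] {N n : ℕ} (e : Fin N × Fin 1 ≃ Fin n)
    (TV : Matrix (Fin N) (Fin N) F) (hVd : IsUnit TV.det) (TW : Matrix (Fin 1) (Fin 1) F) (hWd : IsUnit TW.det)
    (ξ : Fin (n + n) → F)
    (h : ∀ i : Fin N × Fin 1,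
      algebraMap F E (ξ (finSumFinEquiv (Sum.inl (e i)))) +
        algebraMap F E (((Literature.NumberTheory.GelbartRogawski1991.UnitaryDualPair.gram F e TV TW)⁻¹ *ᵥ
          fun j => ξ (finSumFinEquiv (Sum.inr j))) (e i)) * δ = 0) :
    ξ = 0 := by
  have h1 : ∀ k : Fin n, ξ (finSumFinEquiv (Sum.inl k)) = 0 := fun k => by
    have := (algebraMap_add_algebraMap_mul_delta_eq_zero c hcδ hδ (h (e.symm k))).1
    rwa [e.apply_symm_apply] at this
  have h2 : (Literature.NumberTheory.GelbartRogawski1991.UnitaryDualPair.gram F e TV TW)⁻¹ *ᵥ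
      (fun j => ξ (finSumFinEquiv (Sum.inr j))) = 0 := by
    funext k
    have := (algebraMap_add_algebraMap_mul_delta_eq_zero c hcδ hδ (h (e.symm k))).2
    rwa [e.apply_symm_apply] at this
  have h3 : (fun j => ξ (finSumFinEquiv (Sum.inr j))) = 0 := by
    have hdet := Literature.NumberTheory.GelbartRogawski1991.UnitaryDualPair.isUnit_det_gram F e hVd hWd
    have := congrArg ((Literature.NumberTheory.GelbartRogawski1991.UnitaryDualPair.gram F e TV TW) *ᵥ ·) h2
    simpa only [Matrix.mulVec_mulVec, Matrix.mul_nonsing_inv _ hdet, Matrix.one_mulVec, Matrix.mulVec_zero] using this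
  funext x
  rw [Pi.zero_apply, ← finSumFinEquiv.apply_symm_apply x]
  rcases hx : finSumFinEquiv.symm x with k | k
  · exact h1 k
  · exact congrFun h3 k

end Rational

/-! ## §2 The anisotropy of `hNorm` on rational points -/

section RankOne

/-- The rank-one Gram entry `(T_W ⊗ 1)₀₀ ≠ 0` (`det T_W = T_W 0 0` is a unit). [folklore] -/
theorem map_TW_zero_zero_ne_zero {F E : Type} [Field F] [Field E] [Algebra F E] (TW : Matrix (Fin 1) (Fin 1) F)
    (hWd : IsUnit TW.det) : (TW.map (algebraMap F E)) 0 0 ≠ 0 := by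
  rw [Matrix.map_apply, map_ne_zero]
  have h := hWd.ne_zero
  rwa [Matrix.det_fin_one] at h

end RankOne

section HNorm

variable (F E : Type) [Field F] [NumberField F] [Field E] [NumberField E] [Algebra F E] [Algebra.IsQuadraticExtension F E]
  (c : E ≃ₐ[F] E) {δ : E} (hcδ : c δ = -δ) (hδ : δ ≠ 0) {d : F} (hd : δ * δ = algebraMap F E d)
  (N : ℕ) {n : ℕ} (e : Fin N × Fin 1 ≃ Fin n)
  (TV : Matrix (Fin N) (Fin N) F) (hV : TV.IsSymm) (hVd : IsUnit TV.det)
  (TW : Matrix (Fin 1) (Fin 1) F) (hW : TW.IsSymm) (hWd : IsUnit TW.det)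

include hd hV hW in
/-- **ANISOTROPY OF THE HERMITIAN NORM ON RATIONAL POINTS** — `hNorm (ratPt ξ) = 0 ↔ ξ = 0` for `ξ ∈ F^{n+n}`, when `F` is totally real,
`E` totally complex and `J_V = T_V ⊗ 1` is positive definite at the complex embedding `τ` (the CM binders of ★ L1 ED. 3): Weil's «`U(0)_k`
est vide» for the doubled unitary pair, i.e. the `b = 0` fibre of `hNorm` carries no rational point but `0` — whence `μ̂_0 = 0` in (Θ-DEC)
of the I-CLOSE sheet. [folklore] -/
theorem hNorm_ratPt_eq_zero_iff [IsTotallyReal F] [IsTotallyComplex E] (τ : E →+* ℂ)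
    (hτ : ((TV.map (algebraMap F E)).map τ).PosDef) (ξ : Fin (n + n) → F) :
    hNorm F E c hcδ hδ N e TV hVd TW hWd (ratPt F (Fin (n + n)) ξ) = 0 ↔ ξ = 0 := by
  -- the rational vector `z_ξ` of FILE 2e and the rational value `t ∈ F` of `h(z_ξ, z_ξ)`
  obtain ⟨t, ht⟩ := exists_hermForm_self_eq_algebraMap c hcδ hδ TV hV TW hW
    (fun i => algebraMap F E (ξ (finSumFinEquiv (Sum.inl (e i)))) +
      algebraMap F E (((gram F e TV TW)⁻¹ *ᵥ fun j => ξ (finSumFinEquiv (Sum.inr j))) (e i)) * δ)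
  have hval := hNorm_ratPt_eq_algebraMap F E c hcδ hδ hd N e TV hVd TW hWd ξ t ht
  refine ⟨fun h0 => ?_, fun h0 => ?_⟩
  · -- `t = 0`, so `h(z_ξ, z_ξ) = 0`, so `z_ξ = 0` by anisotropy at `τ`, so `ξ = 0`
    have ht0 : t = 0 := by
      rw [hval] at h0
      exact (AdeleRing.algebraMap_injective (𝓞 F) F) (h0.trans (map_zero _).symm)
    rw [ht0, map_zero] at ht
    have hz := hermForm_kronecker_one_self_eq_zero_imp_of_posDef_map_quadratic c hcδ hδ τ (TV.map (algebraMap F E)) hτ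
      (TW.map (algebraMap F E)) (map_TW_zero_zero_ne_zero TW hWd) _ ht
    exact eq_zero_of_ratCoords_eq_zero c hcδ hδ e TV hVd TW hWd ξ fun i => congrFun hz i
  · subst h0
    rw [hval]
    -- for `ξ = 0`: `z_ξ = 0`, `h(0,0) = 0 = t ⊗ 1`, so `t = 0`
    have hz0 : (fun i : Fin N × Fin 1 => algebraMap F E ((0 : Fin (n + n) → F) (finSumFinEquiv (Sum.inl (e i)))) +
        algebraMap F E (((gram F e TV TW)⁻¹ *ᵥ fun j => (0 : Fin (n + n) → F) (finSumFinEquiv (Sum.inr j))) (e i)) * δ) = 0 := by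
      funext i
      simp only [Pi.zero_apply, map_zero, zero_add]
      rw [show (fun j : Fin n => (0 : F)) = 0 from rfl, Matrix.mulVec_zero, Pi.zero_apply, map_zero, zero_mul]
    rw [hz0] at ht
    have ht0 : algebraMap F E t = 0 := by
      rw [← ht]
      simp only [hermForm, Matrix.mulVec_zero, dotProduct_zero]
    rw [map_eq_zero] at ht0
    rw [ht0, map_zero]

end HNorm

end Summit.HodgeConjecture.HodgeConjecture.Cruxes.H413.E2SWHNormAnisotropic
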